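import Summits.QuantumFields.YangMills.Theorems.BalabanUVNodesN19RateEdgeHolderD4AtSqueezedLedgerReading
import Summits.QuantumFields.YangMills.Theorems.BalabanUVNodesN19RateEdgeHolderD4AtN16PinnedReadingFSC
import Summits.QuantumFields.YangMills.Theorems.BalabanUVNodesN19UniformLettersAtU3Pin
import Summits.QuantumFields.YangMills.Theorems.BalabanUVNodesN19BundleDecayLetterFromStub1Rows
import Summits.QuantumFields.YangMills.Theorems.BalabanUVNodesN18PolLimitRateOfGeometricIncrements

/-!
# BalabanUVNodes ∕ N19 — THE N19′ FACE UNDER THE `ForSmallCouplings` PREFIX ∕ IN K3 «v6»'s (B)-FREE CURRENCY AT THE SQUEEZED LEDGER READING, MIRROR-FREE (the supplier the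
# N27 all-pins storeys consume — `forSmallCouplings_h19HolderD4_datumOfRecord₁₃CoPH_of_linkReadingAtN16PinnedReading` (p607220 §1, the N16-PINNED reading, ≈115-line binder) — ONE
# application later at the END-STATE reading `hlinkSqz` (p631491, ≈60-line binder: versus the N16-pinned reading 62 conjuncts ∕ 13 binders OUT), composed from the five LANDED rebuilds
# squeezed → trimmed → ledger → keyed → pinned → N16-pinned; plus the edition in which node U3's two letters `hunif` ∕ `hdecT` are DISCHARGED from stub 1's rows under the (t-U3) pin

Cell `pub-ymgap`, HUMAN RULING D-0062 (Track A), WIDTH SEAT `pub-ymgap-dag-n19-w3` (N19 NE7, seat 3 of 3), generation g5; bus CLAIM-1 ∕ INTENT-1.  Cluster item **K3⁸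
«SpineGivenEndpointR13SepCoPHV» (stmt-QuantumFields-27366)**, skeleton K3 «v6» b4e55110ab73e679 (untouched).  Filed `--kind proof --supports stmt-QuantumFields-27366 --as helper` (proves no
registered stub).  COUNT-NEUTRAL.  THEOREMS ONLY; 0 `def`; 0 `sorry`; `N`-generic, guard-generic `G`, reading-generic `cr`; NO Theses import, NO mirror (`K3V5Defs`∕`K3V6Defs`) import — so the
N27 storeys (which spell the pins) can cite it.  Imports this seat's `…AtSqueezedLedgerReading` (g4, p631491; transitively `…AtTrimmedLedgerReading` p620894, `…AtLedgerReading` p613740,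
`…AtKeyedReading` p611389, `…AtPinnedReading` p609283), `…AtN16PinnedReadingFSC` (g3, p607220) and dag-n19-w5's `…N19UniformLettersAtU3Pin` (p615362) ∕ `…N19BundleDecayLetterFromStub1Rows`
(p616024) and dag-n18-w2's `…N18PolLimitRateOfGeometricIncrements` (the finite-volume door the N27 storeys already import) — CITED BY NAME, none edited.

WHY (located, consumer side).  dag-n27-c's all-pins storeys ∕ leaves (APWᴮ `…N27AtAllPinsOfRecord13CoPHVCutBFreeLinkReading`, AWUⱽ) conclude K3⁸ BY NAME displaying NODE O's link reading
in the ONLY mirror-free `ForSmallCouplings` currency this lineage had landed — the N16-PINNED one.  The later readings existed mirror-free only in per-tuple `_tuned` form and in FSC form only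
keyed on the mirror's `GuardedReadingN16`.  This file closes that gap: every row discharged between the N16-pinned and the squeezed reading is discharged from hypotheses those storeys
ALREADY display (`Ne1PinnedOfRecord 𝔯`, the (t-U3) pin, stub 1's rows, `hmatch`, `hend`, `2∕3 < β`) plus node N16's key-level letters `hradii ∧ hclass` (dag-n16-e module 49∕50 texts) and —
for `hdecT` — W1's (5.10) letter at all 16 direction pairs (dag-n19-w5's located point).

WHAT THIS FILE PROVES (section hypothesis `hlinkSqz` = p631491's text VERBATIM).
§1 ★★ `forSmallCouplings_h19HolderD4_datumOfRecord₁₃CoPH_of_linkReadingAtSqueezedLedgerReading` — p607220 §1's CONCLUSION VERBATIM (`ForSmallCouplings D (fun g₀ ↦ ∀ os k, RatesHolderAt ∧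
   ReadOutAt ∧ ρ-row → ∃ δ, NE7.Core (cr …) … δ ∧ Summable δ)`) at every guarded admissible tuple carrying K1⁷'s window `(γ₀ b b′, 0 < b)` and the uniform letters `(M, ρ₁)`, from `hlinkSqz`,
   `hpin1 : Ne1PinnedOfRecord 𝔯`, the (t-U3) pin `(ℓ, hpinU3)`, `hpinL hmatch hend`, `hradii hclass`, `2∕3 < β ≤ 1`, the bundle decay letter `hdecT`.
§1b ★★ `…_of_linkReadingAtSqueezedLedgerReading_full` — the same keyed on module 50's ten-row bundle `hrowsFull`.
§2 ★★★ `keyedCoreEdgeHolderD4BFree_of_linkReadingAtSqueezedLedgerReading` — K3 «v6»'s (B)-FREE N19′ face `K3V6Defs.KeyedCoreEdgeHolderD4BFree β cr (rrOfRecord 𝔯 ks)` SPELLED (generic `N`,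
   `G`; at `N = 2`, `G θ := θ.ZhUnity F 2 ∧ θ.SlotsNondegenerate₁₃ F 2` the texts coincide, `PHolderD4`∕`rrOfRecord` unfolded) with the run selector `ks`, `hβw`∕`hunif` in per-tuple ∃-form.
§3 ★★ `keyedCoreEdgeHolderD4BFree_of_linkReadingAtSqueezedLedgerReading_stub1Rows` — §2 with `hunif` and `hdecT` DISCHARGED under the (t-U3) pin from stub 1's rows `hs` (signs), `hL`
   (`PolLimitsExistOfRecord₁₃`), `h9` (`WindowedNE9OfRecord₁₃`) and `hWall : ∀ μ ν, WindowedDecayOfRecord₁₃ … μ ν (ℓ F θ).κ` (dag-n19-w5 `hunif_of_u3Pinned_of_signs` ∕ `hdecT_of_u3Pinned_of_stub1Rows`).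
§3b ★★ `keyedCoreEdgeHolderD4BFree_of_linkReadingAtSqueezedLedgerReading_finiteVolumeRows` — §3 in the N27 storeys' EXACT finite-volume currency: `hL` ⟸ the increments letter `hinc :
   GeometricIncrementsOfRecord₁₃ … (r F θ)` with `hr : r F θ < 1` (dag-n18-w2 `polLimitsExistOfRecord₁₃_of_geometricIncrements`); so versus APWᴮ's displayed rows the only NEW letters are
   `hWall` (all 16 pairs instead of `(0, 1)`), `hradii ∧ hclass` and `2∕3 < β` — and `hunif` is gone.

HONEST FRAMING.  Count-neutral kernel bookkeeping — compositions of LANDED rebuild lemmas, ZERO estimate content; `hlinkSqz` (NODE O's world; 0 instances), `hradii`∕`hclass`∕`hrowsFull`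
(node N16's key-level letters, displayed for no family), `hdecT` ∕ stub 1's rows, the pins, v5∕v6's N16 rows, K1⁷'s window are HYPOTHESES; `cr 𝔯 G ℓ ℓ₃ g B c' ks` PARAMETERS.  NOT a proof
of any stub or of K3⁸; no skeleton text touched; nothing of Bałaban's asserted or instantiated (K0⁷ OPEN); NE7 NOT PRINTED ∕ NOT proved; N14 ∕ N16 ∕ N19 ∕ N22 NOT discharged; K3⁸ OPEN, NOT
claimed; counts unmoved (typed 28∕28 · discharged 5∕27 · A 5∕28).  One finite four-torus at fixed ε — R4 closes the CONDITIONAL finite-𝕋⁴ rung `BalabanLadder.UV` only; NOT infinite volume ∕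
OS ∕ mass gap; the YM mass gap (Clay) is NOT proved by any of this.  Standard axioms.  Edits nothing.
-/

set_option autoImplicit false

noncomputable section

open Finset MeasureTheory
open scoped BigOperators Matrix Matrix.Norms.L2Operator

namespace Summit.QuantumFields.YangMills.BalabanUVNodes.N19RateEdgeHolderD4AtSqueezedLedgerReadingFSC

open Literature.MathematicalPhysics.QuantumFieldTheory.Balaban1983to89
open T4OutputRate T4RecentScale T4GoodClassBudget T4CauchySum T4TowerRateComposition T4TowerRateDischarge
open T4EtaRateMin (Readings NE3Shape)
open T4RateLiaison (GaugeDominated)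
open FlowStep (RGEqH prefixOf)
open TreeLengthTorus (TFaceConnected torusTreeLen)
open B12TreeDecay (kappa₀)
open Summit.QuantumFields.BalabanUV.T4Continuum
open AveragingDeficitDualResidual (dualC1 dualC2)
open AveragingDeficitDerivWallProof (wallConst)
open AveragingDeficitPeriodicCounting (IsPeriodicDir)
open MinimalActionSandwich (IsMinimiser minAct)
open MinimalActionRate (sfClass)
open MinimalActionRefine (RegularSup gradConst)
open NE3EnergyShapes (IsUnitarySite IsPeriodicSite)
open NE3.LeafIndexSockets (LeafH3sup)
open Summit.QuantumFields.BalabanUV.T4Continuum.Spine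
open Summit.QuantumFields.BalabanUV.T4Continuum.Spine.NE4 (runFlow)
open Summit.QuantumFields.BalabanUV.T4Continuum.NE1p.DressedRoot (DressedTower DressedStabilityStrict)
open Summit.QuantumFields.YangMills.BalabanUVNodes.N19LedgerLinkSync (LedgerDataSync LedgerAtSync)
open YMDAG.UVSplit (SpineCarriers SpineRecordPred InputsPred U3Carriers RateCarriers RateRecordPred N14At N18At N22At ReadOutAt)
open Summit.QuantumFields.YangMills.BalabanUVNodes.N16HolderDefs (CovRootHolder N16HolderAt)
open Summit.QuantumFields.YangMills.BalabanUVNodes.SpineRatesHolder (RatesHolderAt)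
open Literature.MathematicalPhysics.QuantumFieldTheory.Balaban1983to89.T4Continuum (T4Family ULoop)
open YMDAG.UVSplit (Datum RateReading₁₃CoPH rateCarriersOfRecord₁₃CoPH ne3OfRecord₁₁)
open Node00 (Stage13HParams datumOfRecord₁₃CoPH SiteSeqKey NE3Letters₁₁ ne3ConstLayerOfRecord₁₁ ne3NperOfRecord₁₁ ne3DomOfRecord₁₁)
open Summit.QuantumFields.YangMills.BalabanUVNodes.N16PinnedLayer13CoPH (N16PinnedLoose N16LettersEnd rateCarriers_ne3_of_pinnedLoose)
open YMDAG.N14.TopBorn (ne1OfRecord obsSupNorm)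
open YMDAG.N14.TopBorn (obsSupNorm_nonneg)
open Node00 (U3Letters₁₁)
open Literature.MathematicalPhysics.QuantumFieldTheory.Balaban1983to89.Node00.U3OfKernels (objectsOfRecord₁₃)

open Literature.MathematicalPhysics.QuantumFieldTheory.Balaban1983to89.Node00.U3KernelLetters (PolLimitsExistOfRecord₁₃ WindowedNE9OfRecord₁₃ WindowedDecayOfRecord₁₃
  GeometricIncrementsOfRecord₁₃)
open T4ContinuumYM4Torus (ForSmallCouplings)
open YMDAG.N14.TopBorn (Ne1PinnedOfRecord)
open Summit.QuantumFields.YangMills.BalabanUVNodes.N19RateEdgeHolderD4AtN16PinnedReadingFSC (forSmallCouplings_h19HolderD4_datumOfRecord₁₃CoPH_of_linkReadingAtN16PinnedReading)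
open Summit.QuantumFields.YangMills.BalabanUVNodes.N19RateEdgeHolderD4AtPinnedReading (linkReadingAtN16PinnedReading_of_linkReadingAtPinnedReading)
open Summit.QuantumFields.YangMills.BalabanUVNodes.N19RateEdgeHolderD4AtKeyedReading (linkReadingAtPinnedReading_of_linkReadingAtKeyedReading)
open Summit.QuantumFields.YangMills.BalabanUVNodes.N19RateEdgeHolderD4AtLedgerReading (linkReadingAtKeyedReading_of_linkReadingAtLedgerReading)
open Summit.QuantumFields.YangMills.BalabanUVNodes.N19RateEdgeHolderD4AtTrimmedLedgerReading (linkReadingAtLedgerReading_of_linkReadingAtTrimmedLedgerReading)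
open Summit.QuantumFields.YangMills.BalabanUVNodes.N19RateEdgeHolderD4AtSqueezedLedgerReading (linkReadingAtTrimmedLedgerReading_of_linkReadingAtSqueezedLedgerReading
  linkReadingAtTrimmedLedgerReading_of_linkReadingAtSqueezedLedgerReading_full)
open Summit.QuantumFields.YangMills.BalabanUVNodes.N19UniformLettersAtU3Pin (hunif_of_u3Pinned_of_signs)
open Summit.QuantumFields.YangMills.BalabanUVNodes.N19BundleDecayLetterFromStub1Rows (hdecT_of_u3Pinned_of_stub1Rows)
open YMDAG.N18.PolLimitRate (polLimitsExistOfRecord₁₃_of_geometricIncrements)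

variable {N : ℕ} [NeZero N]

section AtSqueezedLedgerReadingFSC

variable
  (cr : (F : T4Family) → (θ : Stage13HParams F N) → θ.Provisos₁₃CoPH F N → (ℕ → ℝ) → List (ULoop F) → SpineCarriers)
  (𝔯 : RateReading₁₃CoPH N) (G : ∀ {F : T4Family}, Stage13HParams F N → Prop) {β : ℝ} (hβ1 : β ≤ 1)
  {ℓ₃ : T4Family → NE3Letters₁₁} {g B c' : T4Family → ℝ}
  (hlinkSqz : ∀ (F : T4Family) (θ : Stage13HParams F N) (hP : θ.Provisos₁₃CoPH F N), G θ → θ.Admissible F N →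
    ∀ (γ gIR b : ℝ) (g₀ : ℕ → ℝ), (datumOfRecord₁₃CoPH F N θ hP).Tuned γ gIR g₀ → γ ≤ θ.γ → γ ^ 2 ≤ Real.exp (-1) → 0 < b →
    (∀ K m, 0 ≤ m → m < K → b ≤ (datumOfRecord₁₃CoPH F N θ hP).βfun m (prefixOf (runFlow (datumOfRecord₁₃CoPH F N θ hP) g₀ K) m)) →
    ∀ (os : List (ULoop F)) (k : ℕ),
      let S : SpineCarriers := cr F θ hP g₀ os
      let R : RateCarriers N := rateCarriersOfRecord₁₃CoPH 𝔯 F θ hP g₀ os k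
      let D : Datum F N := datumOfRecord₁₃CoPH F N θ hP
      letI := S.dec
      ∃ (_ : DecidableEq R.u3.C.Dom) (F' : Type) (ι' X' : Type) (_ : MeasurableSpace ι')
        (L : LedgerDataSync R.u3.C F' ι' S.ι) (Rd : Readings ι' X') (bsel : (ℕ → ℝ) → ℝ) (EB : Functional R.u3.C R.u3.C.BgB)
        (g : ℕ → ℕ → ℝ)
        (uA : ℕ → ι' → R.u3.C.BgA) (uB : ℕ → ι' → R.u3.C.BgB)
        (Pf : ℕ → Params) (d₀ L₀ Koff : ℕ) (cells : (K j : ℕ) → R.u3.C.Dom → Finset (Site (Pf K) j))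
        (H033 : Flow → ℕ → Prop) (I : Type) (fam : I → B14.Sect2Data) (Lb βw : ℝ) (κ₁ : ℕ) (Gv Cl : ℝ) (K₁ : ℕ)
        (θ : ℝ)
        (sel : ℕ → (B7Prop1Explicit.Site 4 → Fin 4 → (Matrix (Fin N) (Fin N) ℂ)ˣ) → (B7Prop1Explicit.Site 4 → Fin 4 → (Matrix (Fin N) (Fin N) ℂ)ˣ))
        (rd : ι' → (B7Prop1Explicit.Site 4 → Fin 4 → (Matrix (Fin N) (Fin N) ℂ)ˣ)),
        (∀ K i, i ≤ K → g K i = runFlow D g₀ K i) ∧ (∀ K i, K < i → g K i = gIR) ∧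
        EB = (fun s => R.u3.EB (bsel s) s) ∧
        (∀ (Sz : ℕ → ℝ → S.ι → ℕ → ℝ) (E₀ : ℝ) (m : ℕ) (a : ℝ) (Cw Λg : ℝ),
          (∀ K t, |t| ≤ S.l₀ → ∀ τ ∈ S.T K \ S.Bad K t, ∀ v ∈ Rd.dom, ∀ j ≤ K,
            |∑ X ∈ L.fac K t τ with R.u3.C.scale X = j,
                (Real.log (Real.exp (EB (fun i => g (K + 1) (i + 1)) (uB K v) X
                    - EB (fun i => g (K + 1) (i + 1)) L.oneB X))
                  - Real.log (Real.exp (R.u3.EA (g K) (uA K v) X - R.u3.EA (g K) L.oneA X)))| ≤ Sz K t τ j) →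
          0 ≤ E₀ → 0 < a → a < 1 →
          (∀ K t, |t| ≤ S.l₀ → ∀ τ ∈ S.T K \ S.Bad K t, ∀ j ≤ K,
            Sz K t τ j ≤ S.vol * (E₀ * ((K : ℝ) + 1) ^ m * a ^ (K - j))) →
          (∀ K, Multiplicity (L.All K) R.u3.C.scale (fun X => Real.exp (-(R.u3.κ * R.u3.C.d X))) Cw S.vol Λg K) →
          (∀ K t, |t| ≤ S.l₀ → ∀ τ ∈ S.T K \ S.Bad K t,
            WindowMultiplicity (L.facO K t τ) L.scO L.wO Cw S.vol Λg (jlogOf L.Cl K) K) →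
          1 ≤ Λg → L.θ' ≤ Λg →
          LedgerAtSync { L with S := Sz, E₀ := E₀, m := m, a := a, Cw := Cw, Λg := Λg } S.l₀ S.vol S.T S.Bad
            (fun K t τ => S.A K t τ - S.shA K t τ) (fun K t τ => S.B K t τ - S.shB K t τ) Rd R.u3.EA EB R.u3.κ g uA uB
            R.u3.ω R.u3.ρ R.u3.θ (θ ^ ((3 : ℝ) * β - 2))) ∧
        0 ≤ S.vol ∧
        (∀ K t, |t| ≤ S.l₀ → ∀ τ ∈ S.T K \ S.Bad K t,
          WindowMultiplicity (L.facO K t τ) L.scO L.wO L.Cw S.vol L.Λg (jlogOf L.Cl K) K) ∧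
        0 ≤ L.Cw ∧ 1 ≤ L.Λg ∧ L.θ' ≤ L.Λg ∧
        (∀ K, (Pf K).d = d₀) ∧ (∀ K, (Pf K).L = L₀) ∧ (∀ K, (Pf K).K = Koff + K) ∧
        (∀ K, (Fintype.card (Site (Pf K) (Pf K).K) : ℝ) = S.vol) ∧
        kappa₀ (4 * 2 ^ d₀) (2 * d₀) ≤ R.u3.κ ∧
        (∀ K, ∀ X ∈ L.All K,
          (cells K (R.u3.C.scale X + Koff) X).Nonempty ∧ TFaceConnected (cells K (R.u3.C.scale X + Koff) X)) ∧
        (∀ K j, Set.InjOn (cells K j) ↑((L.All K).filter fun X => R.u3.C.scale X + Koff = j)) ∧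
        (∀ K, ∀ X ∈ L.All K, torusTreeLen (cells K (R.u3.C.scale X + Koff) X) ≤ R.u3.C.d X) ∧
        B14.Thm2Printed H033 fam Lb βw κ₁ ∧ βw < 1 ∧ 0 < βw ∧ 1 < Lb ∧ 1 ≤ Gv ∧ 0 ≤ Cl ∧
        (∀ K t, |t| ≤ S.l₀ → ∀ τ ∈ S.T K \ S.Bad K t, ∀ j ≤ K, ∃ (i : I) (w : (fam i).Ω) (j' : ℕ),
          (fam i).flow.SatisfiesRG (fam i).K ∧ H033 (fam i).flow (fam i).K ∧ 1 ≤ j' ∧ j' ≤ (fam i).K ∧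
          (fam i).K - j' = K - j ∧ (fam i).K ≤ K + K₁ ∧
          (∀ n, 0 ≤ (fam i).gammaVol n w) ∧ (fam i).gammaVol (fam i).K w ≤ S.vol ∧
          (∀ n, n < (fam i).K → n < jlogOf Cl (fam i).K → (fam i).gammaVol n w = 0) ∧
          (∀ n, n < (fam i).K → jlogOf Cl (fam i).K ≤ n → (fam i).gammaVol n w ≤ S.vol * Gv ^ ((fam i).K - n))) ∧
        LeafH3sup 4 R.ne3.L R.ne3.Nper R.ne3.ε R.ne3.b (c' F) R.ne3.dom ∧
        (∀ V ∈ R.ne3.dom, ∀ k : ℕ, IsMinimiser 4 (sfClass 4 R.ne3.L R.ne3.Nper R.ne3.ε) R.ne3.L R.ne3.Nper k V (sel k V)) ∧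
        (∀ V ∈ R.ne3.dom, ∀ k : ℕ, RegularSup 4 R.ne3.L R.ne3.Nper R.ne3.b (c' F) k (sel k V)) ∧
        0 < θ ∧ θ ^ 6 = ((R.ne3.L : ℝ))⁻¹ ∧
        (∀ v ∈ Rd.dom, rd v ∈ R.ne3.dom) ∧
        (∀ k, ∀ v ∈ Rd.dom, Rd.act k v = minAct 4 (sfClass 4 R.ne3.L R.ne3.Nper R.ne3.ε) R.ne3.L R.ne3.Nper k (rd v)) ∧
        (R.ne3.Nper : ℝ) ^ 4 ≤ Rd.vol ∧
        (∀ s ∈ Window γ, 0 < bsel s ∧ bsel s ≤ γ))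

include hlinkSqz

/-! ## §1 N19′'s slot under the `ForSmallCouplings` prefix at the squeezed ledger reading (mirror-free; p607220 §1's conclusion verbatim) -/

include hβ1 in
/-- ★★ **N19′'s SLOT UNDER THE `ForSmallCouplings` PREFIX AT THE SQUEEZED LEDGER READING** [bookkeeping]: at every guarded admissible Stage-13 tuple carrying K1⁷'s window
`BetaBoundsInInterval D.C.toB12 γ₀ b b′` with `0 < b` AND the uniform letters `∀ g₀ os k, 0 < ρ ∧ ρ ≤ ρ₁ ∧ cr·C₉·ω ≤ M` (`ρ₁ < 1`, `0 ≤ M`): FOR ALL SMALL COUPLINGS, every `os k`,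
`RatesHolderAt ∧ ReadOutAt ∧ (0 ≤ ρ ∧ ρ < 1) → ∃ δ, NE7.Core (cr …) … δ ∧ Summable δ` — the sibling's `forSmallCouplings_h19HolderD4_…_of_linkReadingAtN16PinnedReading` (p607220 §1) AT
the squeezed reading: `hlinkSqz` rebuilt to the N16-pinned reading by the five landed rebuilds (squeezed → trimmed: `hpinL hradii hclass`; trimmed → ledger: `2∕3 < β`, `hpinL`, `hend`;
ledger → keyed: `hdecT`; keyed → pinned: the (t-U3) pin; pinned → N16-pinned: the (t-N14) pin `Ne1PinnedOfRecord 𝔯`).  All HYPOTHESES; NOT NE7; N14 ∕ N16 ∕ N19 ∕ N22 NOT discharged;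
NOT `stub_expansion13HV`. -/
theorem forSmallCouplings_h19HolderD4_datumOfRecord₁₃CoPH_of_linkReadingAtSqueezedLedgerReading (hβ23 : 2 / 3 < β) (hpin1 : Ne1PinnedOfRecord 𝔯)
    (ℓ : (F : T4Family) → Stage13HParams F N → U3Letters₁₁)
    (hpinU3 : ∀ (F : T4Family) (θ : Stage13HParams F N) (hP : θ.Provisos₁₃CoPH F N) (g₀ : ℕ → ℝ) (os : List (ULoop F)),
      (𝔯.lit F θ hP g₀ os).u3 = objectsOfRecord₁₃ F N θ.toStage13Params (ℓ F θ))
    (hpinL : N16PinnedLoose 𝔯 ℓ₃ B) (hmatch : ∀ F : T4Family, 0 < B F ∧ (ℓ₃ F).ε / B F ≤ (ℓ₃ F).b) (hend : N16LettersEnd N g ℓ₃)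
    (hradii : ∀ F : T4Family, (ℓ₃ F).g = gradConst 4 (c' F) ∧ 0 ≤ c' F ∧ 0 < c' F ∧ (ℓ₃ F).b ≤ c' F ∧
      (2 : ℝ) ^ 91 * (F.L : ℝ) ^ 17 * c' F ≤ 1 ∧ (2 : ℝ) ^ 76 * (F.L : ℝ) ^ 12 * c' F ≤ (ℓ₃ F).ε ∧ (ℓ₃ F).ε / B F ≤ 1 / 4 ∧ 4 * ((ℓ₃ F).ε / B F) ≤ c' F)
    (hclass : ∀ F : T4Family, 16 * B7Prop2Explicit.C0 4 * (ℓ₃ F).ε ≤ 3 ∧ 1024 * (4 + 1) * (4 + 4) * (F.L : ℝ) ^ 2 * (ℓ₃ F).ε ≤ 1)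
    (hdecT : ∀ (F : T4Family) (θ : Stage13HParams F N) (hP : θ.Provisos₁₃CoPH F N), G θ → θ.Admissible F N → ∀ γ : ℝ, γ ≤ θ.γ →
      ∀ (g₀ : ℕ → ℝ) (os : List (ULoop F)) (k : ℕ), ∃ E₀ : ℝ, 0 ≤ E₀ ∧
        DecayBound (rateCarriersOfRecord₁₃CoPH 𝔯 F θ hP g₀ os k).u3.EA (Window γ) E₀ (rateCarriersOfRecord₁₃CoPH 𝔯 F θ hP g₀ os k).u3.κ)
    (F : T4Family) (θ : Stage13HParams F N) (hP : θ.Provisos₁₃CoPH F N) (hG : G θ) (hθ : θ.Admissible F N) {γ₀ b b' : ℝ} (hγ₀ : 0 < γ₀) (hb0 : 0 < b)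
    (hβ : DagBinding.BetaBoundsInInterval (datumOfRecord₁₃CoPH F N θ hP).C.toB12 γ₀ b b') {M ρ₁ : ℝ} (hM : 0 ≤ M) (hρ₁ : ρ₁ < 1)
    (hunif : ∀ (g₀ : ℕ → ℝ) (os : List (ULoop F)) (k : ℕ), 0 < (rateCarriersOfRecord₁₃CoPH 𝔯 F θ hP g₀ os k).u3.ρ ∧
      (rateCarriersOfRecord₁₃CoPH 𝔯 F θ hP g₀ os k).u3.ρ ≤ ρ₁ ∧
      (rateCarriersOfRecord₁₃CoPH 𝔯 F θ hP g₀ os k).u3.cr * (rateCarriersOfRecord₁₃CoPH 𝔯 F θ hP g₀ os k).u3.C₉ * (rateCarriersOfRecord₁₃CoPH 𝔯 F θ hP g₀ os k).u3.ω ≤ M) :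
    ForSmallCouplings (datumOfRecord₁₃CoPH F N θ hP) fun g₀ => ∀ (os : List (ULoop F)) (k : ℕ),
      (RatesHolderAt (datumOfRecord₁₃CoPH F N θ hP) (rateCarriersOfRecord₁₃CoPH 𝔯 F θ hP g₀ os k) β ∧
        ReadOutAt (datumOfRecord₁₃CoPH F N θ hP) (rateCarriersOfRecord₁₃CoPH 𝔯 F θ hP g₀ os k).u3 ∧
        (0 ≤ (rateCarriersOfRecord₁₃CoPH 𝔯 F θ hP g₀ os k).u3.ρ ∧ (rateCarriersOfRecord₁₃CoPH 𝔯 F θ hP g₀ os k).u3.ρ < 1)) →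
      letI := (cr F θ hP g₀ os).dec
      ∃ δ : ℕ → ℝ, NE7.Core (cr F θ hP g₀ os).l₀ (cr F θ hP g₀ os).vol (cr F θ hP g₀ os).T (cr F θ hP g₀ os).Bad
        (fun K t τ => (cr F θ hP g₀ os).A K t τ - (cr F θ hP g₀ os).shA K t τ) (fun K t τ => (cr F θ hP g₀ os).B K t τ - (cr F θ hP g₀ os).shB K t τ) δ ∧
        Summable δ := by
  obtain ⟨l₀, Λ, hl₀, hΛ, hpin1'⟩ := hpin1
  exact forSmallCouplings_h19HolderD4_datumOfRecord₁₃CoPH_of_linkReadingAtN16PinnedReading cr 𝔯 G hβ1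
    (linkReadingAtN16PinnedReading_of_linkReadingAtPinnedReading cr 𝔯 G
      (linkReadingAtPinnedReading_of_linkReadingAtKeyedReading cr 𝔯 G
        (linkReadingAtKeyedReading_of_linkReadingAtLedgerReading cr 𝔯 G
          (linkReadingAtLedgerReading_of_linkReadingAtTrimmedLedgerReading cr 𝔯 G
            (linkReadingAtTrimmedLedgerReading_of_linkReadingAtSqueezedLedgerReading cr 𝔯 G hlinkSqz hpinL hradii hclass) hβ23 hpinL hend)
          hdecT) hl₀.le ℓ hpinU3) hl₀.le hΛ hpin1')
    hpinL hmatch hend F θ hP hG hθ hγ₀ hb0 hβ hM hρ₁ hunif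

include hβ1 in
/-- ★★ **THE SAME, KEYED ON dag-n16-e's TEN-ROW BUNDLE `hrowsFull`** (module 50's `hrows` text VERBATIM: `hradii`'s eight rows with the class-radius pair inserted) [bookkeeping]: the
squeezed → trimmed rebuild is the sibling's `…_of_linkReadingAtSqueezedLedgerReading_full` (all nine carrier rows from `n16LetterBlock_rateCarriers_of_pinnedLoose`).  All HYPOTHESES; N16 ∕
N19 NOT discharged. -/
theorem forSmallCouplings_h19HolderD4_datumOfRecord₁₃CoPH_of_linkReadingAtSqueezedLedgerReading_full (hβ23 : 2 / 3 < β) (hpin1 : Ne1PinnedOfRecord 𝔯)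
    (ℓ : (F : T4Family) → Stage13HParams F N → U3Letters₁₁)
    (hpinU3 : ∀ (F : T4Family) (θ : Stage13HParams F N) (hP : θ.Provisos₁₃CoPH F N) (g₀ : ℕ → ℝ) (os : List (ULoop F)),
      (𝔯.lit F θ hP g₀ os).u3 = objectsOfRecord₁₃ F N θ.toStage13Params (ℓ F θ))
    (hpinL : N16PinnedLoose 𝔯 ℓ₃ B) (hmatch : ∀ F : T4Family, 0 < B F ∧ (ℓ₃ F).ε / B F ≤ (ℓ₃ F).b) (hend : N16LettersEnd N g ℓ₃)
    (hrowsFull : ∀ F : T4Family, (ℓ₃ F).g = gradConst 4 (c' F) ∧ 0 ≤ c' F ∧ 0 < c' F ∧ (ℓ₃ F).b ≤ c' F ∧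
      (2 : ℝ) ^ 91 * (F.L : ℝ) ^ 17 * c' F ≤ 1 ∧ (2 : ℝ) ^ 76 * (F.L : ℝ) ^ 12 * c' F ≤ (ℓ₃ F).ε ∧
      16 * B7Prop2Explicit.C0 4 * (ℓ₃ F).ε ≤ 3 ∧ 1024 * (4 + 1) * (4 + 4) * (F.L : ℝ) ^ 2 * (ℓ₃ F).ε ≤ 1 ∧
      (ℓ₃ F).ε / B F ≤ 1 / 4 ∧ 4 * ((ℓ₃ F).ε / B F) ≤ c' F)
    (hdecT : ∀ (F : T4Family) (θ : Stage13HParams F N) (hP : θ.Provisos₁₃CoPH F N), G θ → θ.Admissible F N → ∀ γ : ℝ, γ ≤ θ.γ →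
      ∀ (g₀ : ℕ → ℝ) (os : List (ULoop F)) (k : ℕ), ∃ E₀ : ℝ, 0 ≤ E₀ ∧
        DecayBound (rateCarriersOfRecord₁₃CoPH 𝔯 F θ hP g₀ os k).u3.EA (Window γ) E₀ (rateCarriersOfRecord₁₃CoPH 𝔯 F θ hP g₀ os k).u3.κ)
    (F : T4Family) (θ : Stage13HParams F N) (hP : θ.Provisos₁₃CoPH F N) (hG : G θ) (hθ : θ.Admissible F N) {γ₀ b b' : ℝ} (hγ₀ : 0 < γ₀) (hb0 : 0 < b)
    (hβ : DagBinding.BetaBoundsInInterval (datumOfRecord₁₃CoPH F N θ hP).C.toB12 γ₀ b b') {M ρ₁ : ℝ} (hM : 0 ≤ M) (hρ₁ : ρ₁ < 1)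
    (hunif : ∀ (g₀ : ℕ → ℝ) (os : List (ULoop F)) (k : ℕ), 0 < (rateCarriersOfRecord₁₃CoPH 𝔯 F θ hP g₀ os k).u3.ρ ∧
      (rateCarriersOfRecord₁₃CoPH 𝔯 F θ hP g₀ os k).u3.ρ ≤ ρ₁ ∧
      (rateCarriersOfRecord₁₃CoPH 𝔯 F θ hP g₀ os k).u3.cr * (rateCarriersOfRecord₁₃CoPH 𝔯 F θ hP g₀ os k).u3.C₉ * (rateCarriersOfRecord₁₃CoPH 𝔯 F θ hP g₀ os k).u3.ω ≤ M) :
    ForSmallCouplings (datumOfRecord₁₃CoPH F N θ hP) fun g₀ => ∀ (os : List (ULoop F)) (k : ℕ),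
      (RatesHolderAt (datumOfRecord₁₃CoPH F N θ hP) (rateCarriersOfRecord₁₃CoPH 𝔯 F θ hP g₀ os k) β ∧
        ReadOutAt (datumOfRecord₁₃CoPH F N θ hP) (rateCarriersOfRecord₁₃CoPH 𝔯 F θ hP g₀ os k).u3 ∧
        (0 ≤ (rateCarriersOfRecord₁₃CoPH 𝔯 F θ hP g₀ os k).u3.ρ ∧ (rateCarriersOfRecord₁₃CoPH 𝔯 F θ hP g₀ os k).u3.ρ < 1)) →
      letI := (cr F θ hP g₀ os).dec
      ∃ δ : ℕ → ℝ, NE7.Core (cr F θ hP g₀ os).l₀ (cr F θ hP g₀ os).vol (cr F θ hP g₀ os).T (cr F θ hP g₀ os).Bad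
        (fun K t τ => (cr F θ hP g₀ os).A K t τ - (cr F θ hP g₀ os).shA K t τ) (fun K t τ => (cr F θ hP g₀ os).B K t τ - (cr F θ hP g₀ os).shB K t τ) δ ∧
        Summable δ := by
  obtain ⟨l₀, Λ, hl₀, hΛ, hpin1'⟩ := hpin1
  exact forSmallCouplings_h19HolderD4_datumOfRecord₁₃CoPH_of_linkReadingAtN16PinnedReading cr 𝔯 G hβ1
    (linkReadingAtN16PinnedReading_of_linkReadingAtPinnedReading cr 𝔯 G
      (linkReadingAtPinnedReading_of_linkReadingAtKeyedReading cr 𝔯 G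
        (linkReadingAtKeyedReading_of_linkReadingAtLedgerReading cr 𝔯 G
          (linkReadingAtLedgerReading_of_linkReadingAtTrimmedLedgerReading cr 𝔯 G
            (linkReadingAtTrimmedLedgerReading_of_linkReadingAtSqueezedLedgerReading_full cr 𝔯 G hlinkSqz hpinL hrowsFull) hβ23 hpinL hend)
          hdecT) hl₀.le ℓ hpinU3) hl₀.le hΛ hpin1')
    hpinL hmatch hend F θ hP hG hθ hγ₀ hb0 hβ hM hρ₁ hunif

/-! ## §2 K3 «v6»'s (B)-free N19′ face `KeyedCoreEdgeHolderD4BFree β cr (rrOfRecord 𝔯 ks)`, SPELLED, at the squeezed ledger reading -/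

include hβ1 in
/-- ★★★ **K3 «v6»'s (B)-FREE N19′ FACE `KeyedCoreEdgeHolderD4BFree β cr (rrOfRecord 𝔯 ks)`, ITS TEXT SPELLED (generic `N`, `G`), AT THE SQUEEZED LEDGER READING** [bookkeeping]: from
K1⁷'s interval-form window with `0 < b` (`hβw`) and the uniform letters (`hunif`) at every guarded admissible tuple (∃-form), the pins, node N16's rows and key-level letters, `2∕3 < β ≤ 1`,
`hdecT` and `hlinkSqz`: for every `F θ hP` with `G θ`, `θ.Admissible F N`: `ForSmallCouplings D (fun g₀ => ∀ os, (RatesHolderAt D R β ∧ ReadOutAt D R.u3 ∧ (0 ≤ ρ ∧ ρ < 1)) → ∃ δ,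
NE7.Core (cr F θ hP g₀ os) … δ ∧ Summable δ)` at `R := rateCarriersOfRecord₁₃CoPH 𝔯 F θ hP g₀ os (ks …)` — dag-n27-w1's `K3V6Defs.KeyedCoreEdgeHolderD4BFree β cr (rrOfRecord 𝔯 ks)` with
`rrOfRecord`∕`PHolderD4` unfolded (at `N = 2`, `G θ := θ.ZhUnity F 2 ∧ θ.SlotsNondegenerate₁₃ F 2` the texts coincide; NO (B) ∕ END binder); §1's `.mono` at the selected run length.  ONE
FACE-SHAPE of `stub_expansion13HV` modulo its displayed hypotheses — NOT the stub, NOT K3⁸; N14 ∕ N16 ∕ N19 ∕ N22 NOT discharged. -/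
theorem keyedCoreEdgeHolderD4BFree_of_linkReadingAtSqueezedLedgerReading (hβ23 : 2 / 3 < β) (hpin1 : Ne1PinnedOfRecord 𝔯)
    (ℓ : (F : T4Family) → Stage13HParams F N → U3Letters₁₁)
    (hpinU3 : ∀ (F : T4Family) (θ : Stage13HParams F N) (hP : θ.Provisos₁₃CoPH F N) (g₀ : ℕ → ℝ) (os : List (ULoop F)),
      (𝔯.lit F θ hP g₀ os).u3 = objectsOfRecord₁₃ F N θ.toStage13Params (ℓ F θ))
    (hpinL : N16PinnedLoose 𝔯 ℓ₃ B) (hmatch : ∀ F : T4Family, 0 < B F ∧ (ℓ₃ F).ε / B F ≤ (ℓ₃ F).b) (hend : N16LettersEnd N g ℓ₃)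
    (hradii : ∀ F : T4Family, (ℓ₃ F).g = gradConst 4 (c' F) ∧ 0 ≤ c' F ∧ 0 < c' F ∧ (ℓ₃ F).b ≤ c' F ∧
      (2 : ℝ) ^ 91 * (F.L : ℝ) ^ 17 * c' F ≤ 1 ∧ (2 : ℝ) ^ 76 * (F.L : ℝ) ^ 12 * c' F ≤ (ℓ₃ F).ε ∧ (ℓ₃ F).ε / B F ≤ 1 / 4 ∧ 4 * ((ℓ₃ F).ε / B F) ≤ c' F)
    (hclass : ∀ F : T4Family, 16 * B7Prop2Explicit.C0 4 * (ℓ₃ F).ε ≤ 3 ∧ 1024 * (4 + 1) * (4 + 4) * (F.L : ℝ) ^ 2 * (ℓ₃ F).ε ≤ 1)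
    (hdecT : ∀ (F : T4Family) (θ : Stage13HParams F N) (hP : θ.Provisos₁₃CoPH F N), G θ → θ.Admissible F N → ∀ γ : ℝ, γ ≤ θ.γ →
      ∀ (g₀ : ℕ → ℝ) (os : List (ULoop F)) (k : ℕ), ∃ E₀ : ℝ, 0 ≤ E₀ ∧
        DecayBound (rateCarriersOfRecord₁₃CoPH 𝔯 F θ hP g₀ os k).u3.EA (Window γ) E₀ (rateCarriersOfRecord₁₃CoPH 𝔯 F θ hP g₀ os k).u3.κ)
    (ks : (F : T4Family) → (θ : Stage13HParams F N) → θ.Provisos₁₃CoPH F N → (ℕ → ℝ) → List (ULoop F) → ℕ)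
    (hβw : ∀ (F : T4Family) (θ : Stage13HParams F N) (hP : θ.Provisos₁₃CoPH F N), G θ → θ.Admissible F N →
      ∃ γ₀ b b' : ℝ, 0 < γ₀ ∧ 0 < b ∧ DagBinding.BetaBoundsInInterval (datumOfRecord₁₃CoPH F N θ hP).C.toB12 γ₀ b b')
    (hunif : ∀ (F : T4Family) (θ : Stage13HParams F N) (hP : θ.Provisos₁₃CoPH F N), G θ → θ.Admissible F N →
      ∃ M ρ₁ : ℝ, 0 ≤ M ∧ ρ₁ < 1 ∧ ∀ (g₀ : ℕ → ℝ) (os : List (ULoop F)) (k : ℕ), 0 < (rateCarriersOfRecord₁₃CoPH 𝔯 F θ hP g₀ os k).u3.ρ ∧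
        (rateCarriersOfRecord₁₃CoPH 𝔯 F θ hP g₀ os k).u3.ρ ≤ ρ₁ ∧
        (rateCarriersOfRecord₁₃CoPH 𝔯 F θ hP g₀ os k).u3.cr * (rateCarriersOfRecord₁₃CoPH 𝔯 F θ hP g₀ os k).u3.C₉ * (rateCarriersOfRecord₁₃CoPH 𝔯 F θ hP g₀ os k).u3.ω ≤ M) :
    ∀ (F : T4Family) (θ : Stage13HParams F N) (hP : θ.Provisos₁₃CoPH F N), G θ → θ.Admissible F N →
      ForSmallCouplings (datumOfRecord₁₃CoPH F N θ hP) fun g₀ => ∀ os : List (ULoop F),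
        (RatesHolderAt (datumOfRecord₁₃CoPH F N θ hP) (rateCarriersOfRecord₁₃CoPH 𝔯 F θ hP g₀ os (ks F θ hP g₀ os)) β ∧
          ReadOutAt (datumOfRecord₁₃CoPH F N θ hP) (rateCarriersOfRecord₁₃CoPH 𝔯 F θ hP g₀ os (ks F θ hP g₀ os)).u3 ∧
          (0 ≤ (rateCarriersOfRecord₁₃CoPH 𝔯 F θ hP g₀ os (ks F θ hP g₀ os)).u3.ρ ∧ (rateCarriersOfRecord₁₃CoPH 𝔯 F θ hP g₀ os (ks F θ hP g₀ os)).u3.ρ < 1)) →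
        letI := (cr F θ hP g₀ os).dec
        ∃ δ : ℕ → ℝ, NE7.Core (cr F θ hP g₀ os).l₀ (cr F θ hP g₀ os).vol (cr F θ hP g₀ os).T (cr F θ hP g₀ os).Bad
          (fun K t τ => (cr F θ hP g₀ os).A K t τ - (cr F θ hP g₀ os).shA K t τ) (fun K t τ => (cr F θ hP g₀ os).B K t τ - (cr F θ hP g₀ os).shB K t τ) δ ∧
          Summable δ := by
  intro F θ hP hG hθ
  obtain ⟨γ₀, b, b', hγ₀, hb0, hβ⟩ := hβw F θ hP hG hθ
  obtain ⟨M, ρ₁, hM, hρ₁, hu⟩ := hunif F θ hP hG hθ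
  exact (forSmallCouplings_h19HolderD4_datumOfRecord₁₃CoPH_of_linkReadingAtSqueezedLedgerReading cr 𝔯 G hβ1 hlinkSqz hβ23 hpin1 ℓ hpinU3 hpinL hmatch hend hradii hclass
    hdecT F θ hP hG hθ hγ₀ hb0 hβ hM hρ₁ hu).mono fun g₀ h os => h os (ks F θ hP g₀ os)

/-! ## §3 The same with node U3's two letters DISCHARGED from stub 1's rows under the (t-U3) pin (dag-n19-w5's suppliers) -/

include hβ1 in
/-- ★★ **THE (B)-FREE N19′ FACE AT THE SQUEEZED LEDGER READING WITH `hunif` ∕ `hdecT` DISCHARGED FROM STUB 1's ROWS** [bookkeeping]: under the (t-U3) pin the uniform-letters clause is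
stub 1's sign row `hs : (ℓ F θ).Signs` (dag-n19-w5 `hunif_of_u3Pinned_of_signs`, p615362) and the bundle decay letter is `hs` + `hL : PolLimitsExistOfRecord₁₃` + `h9 : WindowedNE9OfRecord₁₃`
+ W1's windowed (5.10) letter AT EVERY DIRECTION PAIR `hWall` (`hdecT_of_u3Pinned_of_stub1Rows`, p616024; the bill's `hW` is the pair `(0, 1)` only — dag-n19-w5's located point) — so the
(B)-free face at the squeezed reading costs: the three pins, `hmatch hend hradii hclass`, `2∕3 < β ≤ 1`, K1⁷'s window `hβw`, stub 1's rows `hs hL h9`, `hWall`, and `hlinkSqz`.  All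
HYPOTHESES; NOT the stub, NOT K3⁸; N14 ∕ N16 ∕ N19 ∕ N22 NOT discharged. -/
theorem keyedCoreEdgeHolderD4BFree_of_linkReadingAtSqueezedLedgerReading_stub1Rows (hβ23 : 2 / 3 < β) (hpin1 : Ne1PinnedOfRecord 𝔯)
    (ℓ : (F : T4Family) → Stage13HParams F N → U3Letters₁₁)
    (hpinU3 : ∀ (F : T4Family) (θ : Stage13HParams F N) (hP : θ.Provisos₁₃CoPH F N) (g₀ : ℕ → ℝ) (os : List (ULoop F)),
      (𝔯.lit F θ hP g₀ os).u3 = objectsOfRecord₁₃ F N θ.toStage13Params (ℓ F θ))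
    (hpinL : N16PinnedLoose 𝔯 ℓ₃ B) (hmatch : ∀ F : T4Family, 0 < B F ∧ (ℓ₃ F).ε / B F ≤ (ℓ₃ F).b) (hend : N16LettersEnd N g ℓ₃)
    (hradii : ∀ F : T4Family, (ℓ₃ F).g = gradConst 4 (c' F) ∧ 0 ≤ c' F ∧ 0 < c' F ∧ (ℓ₃ F).b ≤ c' F ∧
      (2 : ℝ) ^ 91 * (F.L : ℝ) ^ 17 * c' F ≤ 1 ∧ (2 : ℝ) ^ 76 * (F.L : ℝ) ^ 12 * c' F ≤ (ℓ₃ F).ε ∧ (ℓ₃ F).ε / B F ≤ 1 / 4 ∧ 4 * ((ℓ₃ F).ε / B F) ≤ c' F)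
    (hclass : ∀ F : T4Family, 16 * B7Prop2Explicit.C0 4 * (ℓ₃ F).ε ≤ 3 ∧ 1024 * (4 + 1) * (4 + 4) * (F.L : ℝ) ^ 2 * (ℓ₃ F).ε ≤ 1)
    (hs : ∀ (F : T4Family) (θ : Stage13HParams F N), θ.Provisos₁₃CoPH F N → G θ → θ.Admissible F N → (ℓ F θ).Signs)
    (hL : ∀ (F : T4Family) (θ : Stage13HParams F N), θ.Provisos₁₃CoPH F N → G θ → θ.Admissible F N → PolLimitsExistOfRecord₁₃ F N θ.toStage13Params)
    (h9 : ∀ (F : T4Family) (θ : Stage13HParams F N), θ.Provisos₁₃CoPH F N → G θ → θ.Admissible F N →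
      WindowedNE9OfRecord₁₃ F N θ.toStage13Params (ℓ F θ).κ (ℓ F θ).moduli)
    (hWall : ∀ (μ ν : Fin 4) (F : T4Family) (θ : Stage13HParams F N), θ.Provisos₁₃CoPH F N → G θ → θ.Admissible F N →
      WindowedDecayOfRecord₁₃ F N θ.toStage13Params μ ν (ℓ F θ).κ)
    (ks : (F : T4Family) → (θ : Stage13HParams F N) → θ.Provisos₁₃CoPH F N → (ℕ → ℝ) → List (ULoop F) → ℕ)
    (hβw : ∀ (F : T4Family) (θ : Stage13HParams F N) (hP : θ.Provisos₁₃CoPH F N), G θ → θ.Admissible F N →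
      ∃ γ₀ b b' : ℝ, 0 < γ₀ ∧ 0 < b ∧ DagBinding.BetaBoundsInInterval (datumOfRecord₁₃CoPH F N θ hP).C.toB12 γ₀ b b') :
    ∀ (F : T4Family) (θ : Stage13HParams F N) (hP : θ.Provisos₁₃CoPH F N), G θ → θ.Admissible F N →
      ForSmallCouplings (datumOfRecord₁₃CoPH F N θ hP) fun g₀ => ∀ os : List (ULoop F),
        (RatesHolderAt (datumOfRecord₁₃CoPH F N θ hP) (rateCarriersOfRecord₁₃CoPH 𝔯 F θ hP g₀ os (ks F θ hP g₀ os)) β ∧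
          ReadOutAt (datumOfRecord₁₃CoPH F N θ hP) (rateCarriersOfRecord₁₃CoPH 𝔯 F θ hP g₀ os (ks F θ hP g₀ os)).u3 ∧
          (0 ≤ (rateCarriersOfRecord₁₃CoPH 𝔯 F θ hP g₀ os (ks F θ hP g₀ os)).u3.ρ ∧ (rateCarriersOfRecord₁₃CoPH 𝔯 F θ hP g₀ os (ks F θ hP g₀ os)).u3.ρ < 1)) →
        letI := (cr F θ hP g₀ os).dec
        ∃ δ : ℕ → ℝ, NE7.Core (cr F θ hP g₀ os).l₀ (cr F θ hP g₀ os).vol (cr F θ hP g₀ os).T (cr F θ hP g₀ os).Bad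
          (fun K t τ => (cr F θ hP g₀ os).A K t τ - (cr F θ hP g₀ os).shA K t τ) (fun K t τ => (cr F θ hP g₀ os).B K t τ - (cr F θ hP g₀ os).shB K t τ) δ ∧
          Summable δ :=
  keyedCoreEdgeHolderD4BFree_of_linkReadingAtSqueezedLedgerReading cr 𝔯 G hβ1 hlinkSqz hβ23 hpin1 ℓ hpinU3 hpinL hmatch hend hradii hclass
    (hdecT_of_u3Pinned_of_stub1Rows 𝔯 G ℓ hpinU3 hs hL h9 hWall) ks hβw (hunif_of_u3Pinned_of_signs 𝔯 G ℓ hpinU3 hs)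

include hβ1 in
/-- ★★ **THE SAME IN THE N27 STOREYS' FINITE-VOLUME CURRENCY** [bookkeeping]: §3 with stub 1's limit-existence row `hL` DISCHARGED from the geometric volume-increments letter of record
`hinc : GeometricIncrementsOfRecord₁₃ … (r F θ)`, `hr : r F θ < 1` (dag-n18-w2 `polLimitsExistOfRecord₁₃_of_geometricIncrements`, the door APWᴮ already imports) — so the (B)-free N19′ face
at the squeezed reading costs, in dag-n27-c's displayed vocabulary: the three pins, `hmatch hend`, `hs hr hinc h9`, K1⁷'s window `hβw`, PLUS `hWall` (W1's (5.10) letter at all 16 pairs —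
the bill's `hW` is `(0, 1)`), node N16's key-level letters `hradii ∧ hclass`, `2∕3 < β ≤ 1`, and NODE O's `hlinkSqz`.  All HYPOTHESES; NOT the stub, NOT K3⁸; N14 ∕ N16 ∕ N18 ∕ N19 ∕ N22 NOT
discharged. -/
theorem keyedCoreEdgeHolderD4BFree_of_linkReadingAtSqueezedLedgerReading_finiteVolumeRows (hβ23 : 2 / 3 < β) (hpin1 : Ne1PinnedOfRecord 𝔯)
    (ℓ : (F : T4Family) → Stage13HParams F N → U3Letters₁₁)
    (hpinU3 : ∀ (F : T4Family) (θ : Stage13HParams F N) (hP : θ.Provisos₁₃CoPH F N) (g₀ : ℕ → ℝ) (os : List (ULoop F)),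
      (𝔯.lit F θ hP g₀ os).u3 = objectsOfRecord₁₃ F N θ.toStage13Params (ℓ F θ))
    (hpinL : N16PinnedLoose 𝔯 ℓ₃ B) (hmatch : ∀ F : T4Family, 0 < B F ∧ (ℓ₃ F).ε / B F ≤ (ℓ₃ F).b) (hend : N16LettersEnd N g ℓ₃)
    (hradii : ∀ F : T4Family, (ℓ₃ F).g = gradConst 4 (c' F) ∧ 0 ≤ c' F ∧ 0 < c' F ∧ (ℓ₃ F).b ≤ c' F ∧
      (2 : ℝ) ^ 91 * (F.L : ℝ) ^ 17 * c' F ≤ 1 ∧ (2 : ℝ) ^ 76 * (F.L : ℝ) ^ 12 * c' F ≤ (ℓ₃ F).ε ∧ (ℓ₃ F).ε / B F ≤ 1 / 4 ∧ 4 * ((ℓ₃ F).ε / B F) ≤ c' F)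
    (hclass : ∀ F : T4Family, 16 * B7Prop2Explicit.C0 4 * (ℓ₃ F).ε ≤ 3 ∧ 1024 * (4 + 1) * (4 + 4) * (F.L : ℝ) ^ 2 * (ℓ₃ F).ε ≤ 1)
    (hs : ∀ (F : T4Family) (θ : Stage13HParams F N), θ.Provisos₁₃CoPH F N → G θ → θ.Admissible F N → (ℓ F θ).Signs)
    (r : (F : T4Family) → Stage13HParams F N → ℝ)
    (hr : ∀ (F : T4Family) (θ : Stage13HParams F N), θ.Provisos₁₃CoPH F N → G θ → θ.Admissible F N → r F θ < 1)
    (hinc : ∀ (F : T4Family) (θ : Stage13HParams F N), θ.Provisos₁₃CoPH F N → G θ → θ.Admissible F N →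
      GeometricIncrementsOfRecord₁₃ F N θ.toStage13Params (r F θ))
    (h9 : ∀ (F : T4Family) (θ : Stage13HParams F N), θ.Provisos₁₃CoPH F N → G θ → θ.Admissible F N →
      WindowedNE9OfRecord₁₃ F N θ.toStage13Params (ℓ F θ).κ (ℓ F θ).moduli)
    (hWall : ∀ (μ ν : Fin 4) (F : T4Family) (θ : Stage13HParams F N), θ.Provisos₁₃CoPH F N → G θ → θ.Admissible F N →
      WindowedDecayOfRecord₁₃ F N θ.toStage13Params μ ν (ℓ F θ).κ)
    (ks : (F : T4Family) → (θ : Stage13HParams F N) → θ.Provisos₁₃CoPH F N → (ℕ → ℝ) → List (ULoop F) → ℕ)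
    (hβw : ∀ (F : T4Family) (θ : Stage13HParams F N) (hP : θ.Provisos₁₃CoPH F N), G θ → θ.Admissible F N →
      ∃ γ₀ b b' : ℝ, 0 < γ₀ ∧ 0 < b ∧ DagBinding.BetaBoundsInInterval (datumOfRecord₁₃CoPH F N θ hP).C.toB12 γ₀ b b') :
    ∀ (F : T4Family) (θ : Stage13HParams F N) (hP : θ.Provisos₁₃CoPH F N), G θ → θ.Admissible F N →
      ForSmallCouplings (datumOfRecord₁₃CoPH F N θ hP) fun g₀ => ∀ os : List (ULoop F),
        (RatesHolderAt (datumOfRecord₁₃CoPH F N θ hP) (rateCarriersOfRecord₁₃CoPH 𝔯 F θ hP g₀ os (ks F θ hP g₀ os)) β ∧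
          ReadOutAt (datumOfRecord₁₃CoPH F N θ hP) (rateCarriersOfRecord₁₃CoPH 𝔯 F θ hP g₀ os (ks F θ hP g₀ os)).u3 ∧
          (0 ≤ (rateCarriersOfRecord₁₃CoPH 𝔯 F θ hP g₀ os (ks F θ hP g₀ os)).u3.ρ ∧ (rateCarriersOfRecord₁₃CoPH 𝔯 F θ hP g₀ os (ks F θ hP g₀ os)).u3.ρ < 1)) →
        letI := (cr F θ hP g₀ os).dec
        ∃ δ : ℕ → ℝ, NE7.Core (cr F θ hP g₀ os).l₀ (cr F θ hP g₀ os).vol (cr F θ hP g₀ os).T (cr F θ hP g₀ os).Bad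
          (fun K t τ => (cr F θ hP g₀ os).A K t τ - (cr F θ hP g₀ os).shA K t τ) (fun K t τ => (cr F θ hP g₀ os).B K t τ - (cr F θ hP g₀ os).shB K t τ) δ ∧
          Summable δ :=
  keyedCoreEdgeHolderD4BFree_of_linkReadingAtSqueezedLedgerReading_stub1Rows cr 𝔯 G hβ1 hlinkSqz hβ23 hpin1 ℓ hpinU3 hpinL hmatch hend hradii hclass hs
    (fun F θ hP hG hθ => polLimitsExistOfRecord₁₃_of_geometricIncrements F N θ.toStage13Params (hr F θ hP hG hθ) (hinc F θ hP hG hθ)) h9 hWall ks hβw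

end AtSqueezedLedgerReadingFSC
end Summit.QuantumFields.YangMills.BalabanUVNodes.N19RateEdgeHolderD4AtSqueezedLedgerReadingFSC
end
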